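import Summits.Ventures.HSemireg.WedgeHankelRecurrenceSignatureCoprime
import Summits.Ventures.HSemireg.WedgeHankelRecurrenceSignatureTrace

/-!
# Venture HSemireg — THE TRACE FORM OF `K[X]/(m₁m₂)` HAS THE INERTIA OF THE ORTHOGONAL SUM OF THOSE OF `K[X]/(m₁)` AND `K[X]/(m₂)` (coprime `m₁`, `m₂`; Chinese remainder in Mathlib's `Algebra.traceForm` language):
# for `m₁`, `m₂` monic COPRIME over a linearly ordered field `K` and any weight `a ∈ K[X]`, **`sigPos (f ↦ Tr_{K[X]/(m₁m₂)}(a f²)) = sigPos (f ↦ Tr_{K[X]/(m₁)}(a f²)) + sigPos (f ↦ Tr_{K[X]/(m₂)}(a f²))`**, the same for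
# `sigNeg` — N136's Hankel additivity transported through N130's Gram identity `Her = Tr` (g33's OPEN item (a) «CRT block form of the trace form for coprime `m₁m₂`», closed)

HONEST FRAMING. Part of the Lean index of the computation cell `pub-hsemireg` (seat p10 gen 34, Sunday typer «UNIFORM-IN-n»).
LINEAR ALGEBRA ONLY (Mathlib's `Algebra.traceForm`, `AdjoinRoot`, `LinearMap.BilinForm.compLeft`, `sigPos` ∕ `sigNeg`): no variety, no cohomology theory, no sheaf, no Ext group and no semiregularity map is constructed here;
nothing here says that HC / HC_CM / HC_AV holds; no Literature fact is declared or used.  Custodian versions as in `WedgeHankelSiegelIdeal` (1/3).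
SOURCE OF THE ARGUMENT (classical, cited not used): `K[X]/(m₁m₂) ≅ K[X]/(m₁) × K[X]/(m₂)` (Chinese remainder) is an isomorphism of `K`-algebras, the trace of a product algebra is the sum of the traces, so the trace
form `(f, g) ↦ Tr(a f g)` is the ORTHOGONAL SUM of the two trace forms and the inertia indices add (Sylvester).  Here this is NOT re-proved through `AdjoinRoot` ≅ products (Mathlib has `Ideal.quotientInfEquivQuotientProd`
but no trace-of-product-algebra lemma in the needed shape); instead N130 (`Her(P,Q) = Tr(L_{Qf²})` as a `QuadraticMap.Equivalent`) moves each of the three trace forms to the lineage's Hankel form and N136 adds them.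
DEDUP DISCLOSURE (`rg` of the whole tree + Mathlib, 2026-09-01): no statement on the inertia ∕ signature of `Algebra.traceForm` of a product algebra or of `AdjoinRoot (m₁ * m₂)` exists (`rg traceForm` ∩ CRT words =
number-theory files on other objects); PROVED Literature `RingTheory/ZeroDimensional/HermiteForm.lean` ∕ `Algebra/Polynomial/TraceFormSignature.lean` compute trace-form signatures by ROOT COUNTS under «all roots
`K`-rational»; the present statement needs no roots.  3 names: 0 hits tree-wide.

WHAT IS IN THE TREE.  N130 (`WedgeHankelRecurrenceSignatureTrace`): `sigPos_traceForm_compLeft_mulLeft_eq` ∕ `sigNeg_traceForm_compLeft_mulLeft_eq` (`sigPos (f ↦ Tr(a f²)) = sigPos H_t(a·m′/m)`, `deg m = t + 1`).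
N136 (`WedgeHankelRecurrenceSignatureCoprime`): `sigPos_hankelSq_dualSeq_mul_derivative_of_isCoprime` ∕ `sigNeg_…` (Hermite's symbols add over coprime factors, any `t + 1 ≥ deg(m₁m₂)`).
THIS FILE (namespace `Summit.Ventures.HSemireg.Wedge.HankelOuter` continued; CHAINED on N136, PLAIN on N130; 0 definitions):
* §734 **`sigPos_traceForm_compLeft_mulLeft_mul_of_isCoprime`** ∕ **`sigNeg_traceForm_compLeft_mulLeft_mul_of_isCoprime`** (the additivity for `f ↦ Tr(a f²)`), `sigPos_sigNeg_traceForm_mul_of_isCoprime` (`a = 1`: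
  Mathlib's plain `Algebra.traceForm K (AdjoinRoot (m₁ * m₂))`).
CAVEATS.  `m₁`, `m₂` MONIC of POSITIVE degree (N130's `deg m = t + 1`); `K` linearly ordered; the algebra isomorphism itself is not constructed (only the inertia identity is proved).
Nothing Ext-side.  New names only.
-/

open Module Polynomial
open scoped Matrix Polynomial

namespace Summit.Ventures.HSemireg.Wedge.HankelOuter

open Summit.Ventures.HSemireg.Wedge Summit.Ventures.HSemireg.Wedge.Hankel

variable {K : Type*} [Field K] [LinearOrder K] [IsStrictOrderedRing K]

/-! ## §734. Chinese remainder for the inertia of Mathlib's trace form on `K[X]/(m₁m₂)` -/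

/-- **`sigPos (f ↦ Tr_{K[X]/(m₁m₂)}(a·f²)) = sigPos (f ↦ Tr_{K[X]/(m₁)}(a·f²)) + sigPos (f ↦ Tr_{K[X]/(m₂)}(a·f²))`** for `m₁`, `m₂` monic coprime of degrees `e₁ + 1`, `e₂ + 1` over a linearly ordered field and any
`a ∈ K[X]` (N130 three times + N136 at size `t + 1 = deg(m₁m₂)`). [this file, §734] -/
theorem sigPos_traceForm_compLeft_mulLeft_mul_of_isCoprime {e₁ e₂ : ℕ} {m₁ m₂ : K[X]} (hm₁ : m₁.Monic) (hm₂ : m₂.Monic) (hc : IsCoprime m₁ m₂) (hd₁ : m₁.natDegree = e₁ + 1) (hd₂ : m₂.natDegree = e₂ + 1) (a : K[X]) :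
    sigPos ((Algebra.traceForm K (AdjoinRoot (m₁ * m₂))).compLeft (LinearMap.mulLeft K (AdjoinRoot.mk (m₁ * m₂) a))).toQuadraticMap
      = sigPos ((Algebra.traceForm K (AdjoinRoot m₁)).compLeft (LinearMap.mulLeft K (AdjoinRoot.mk m₁ a))).toQuadraticMap
        + sigPos ((Algebra.traceForm K (AdjoinRoot m₂)).compLeft (LinearMap.mulLeft K (AdjoinRoot.mk m₂ a))).toQuadraticMap := by
  have hmd : (m₁ * m₂).natDegree = (e₁ + e₂ + 1) + 1 := by rw [hm₁.natDegree_mul hm₂, hd₁, hd₂]; ring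
  rw [sigPos_traceForm_compLeft_mulLeft_eq (hm₁.mul hm₂) hmd a, sigPos_traceForm_compLeft_mulLeft_eq hm₁ hd₁ a, sigPos_traceForm_compLeft_mulLeft_eq hm₂ hd₂ a]
  exact sigPos_hankelSq_dualSeq_mul_derivative_of_isCoprime hm₁ hm₂ hc hd₁ hd₂ le_rfl a

/-- **`sigNeg (f ↦ Tr_{K[X]/(m₁m₂)}(a·f²)) = sigNeg (… m₁ …) + sigNeg (… m₂ …)`** (same hypotheses). [this file, §734] -/
theorem sigNeg_traceForm_compLeft_mulLeft_mul_of_isCoprime {e₁ e₂ : ℕ} {m₁ m₂ : K[X]} (hm₁ : m₁.Monic) (hm₂ : m₂.Monic) (hc : IsCoprime m₁ m₂) (hd₁ : m₁.natDegree = e₁ + 1) (hd₂ : m₂.natDegree = e₂ + 1) (a : K[X]) :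
    sigNeg ((Algebra.traceForm K (AdjoinRoot (m₁ * m₂))).compLeft (LinearMap.mulLeft K (AdjoinRoot.mk (m₁ * m₂) a))).toQuadraticMap
      = sigNeg ((Algebra.traceForm K (AdjoinRoot m₁)).compLeft (LinearMap.mulLeft K (AdjoinRoot.mk m₁ a))).toQuadraticMap
        + sigNeg ((Algebra.traceForm K (AdjoinRoot m₂)).compLeft (LinearMap.mulLeft K (AdjoinRoot.mk m₂ a))).toQuadraticMap := by
  have hmd : (m₁ * m₂).natDegree = (e₁ + e₂ + 1) + 1 := by rw [hm₁.natDegree_mul hm₂, hd₁, hd₂]; ring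
  rw [sigNeg_traceForm_compLeft_mulLeft_eq (hm₁.mul hm₂) hmd a, sigNeg_traceForm_compLeft_mulLeft_eq hm₁ hd₁ a, sigNeg_traceForm_compLeft_mulLeft_eq hm₂ hd₂ a]
  exact sigNeg_hankelSq_dualSeq_mul_derivative_of_isCoprime hm₁ hm₂ hc hd₁ hd₂ le_rfl a

/-- **The plain trace forms (`a = 1`): `sigPos Tr_{K[X]/(m₁m₂)}(f²) = sigPos Tr_{K[X]/(m₁)}(f²) + sigPos Tr_{K[X]/(m₂)}(f²)` and the same for `sigNeg`** — the inertia of Mathlib's `Algebra.traceForm K (AdjoinRoot (m₁ * m₂))`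
is that of the orthogonal sum (over a real closed field: `#real roots` and `#conjugate pairs` both add over coprime factors, N130 §715). [this file, §734] -/
theorem sigPos_sigNeg_traceForm_mul_of_isCoprime {e₁ e₂ : ℕ} {m₁ m₂ : K[X]} (hm₁ : m₁.Monic) (hm₂ : m₂.Monic) (hc : IsCoprime m₁ m₂) (hd₁ : m₁.natDegree = e₁ + 1) (hd₂ : m₂.natDegree = e₂ + 1) :
    sigPos (Algebra.traceForm K (AdjoinRoot (m₁ * m₂))).toQuadraticMap = sigPos (Algebra.traceForm K (AdjoinRoot m₁)).toQuadraticMap + sigPos (Algebra.traceForm K (AdjoinRoot m₂)).toQuadraticMap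
      ∧ sigNeg (Algebra.traceForm K (AdjoinRoot (m₁ * m₂))).toQuadraticMap = sigNeg (Algebra.traceForm K (AdjoinRoot m₁)).toQuadraticMap + sigNeg (Algebra.traceForm K (AdjoinRoot m₂)).toQuadraticMap := by
  have h1 : ∀ m : K[X], (Algebra.traceForm K (AdjoinRoot m)).compLeft (LinearMap.mulLeft K (AdjoinRoot.mk m 1)) = Algebra.traceForm K (AdjoinRoot m) := fun m => by
    ext f g
    rw [LinearMap.BilinForm.compLeft_apply, map_one, LinearMap.mulLeft_apply, one_mul]
  have hp := sigPos_traceForm_compLeft_mulLeft_mul_of_isCoprime hm₁ hm₂ hc hd₁ hd₂ 1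
  have hn := sigNeg_traceForm_compLeft_mulLeft_mul_of_isCoprime hm₁ hm₂ hc hd₁ hd₂ 1
  rw [h1, h1, h1] at hp hn
  exact ⟨hp, hn⟩

end Summit.Ventures.HSemireg.Wedge.HankelOuter
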